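import Summits.SmoothPoincare4.SmoothPoincare4.Theorems.ConvexBisectionAcyclicBisectionExistsPageRotationCalculus
import HarnessLib

/-!
# The page-rotation vector field on the Lefschetz base
(wave 3, brick T1a, part 2, of stub `stub_steinRealisation` = NF6
`Literature.Geometry.Symplectic.steinRealisation_of_sorted_modelsOnFibred`, line `modp-braid-orbits`
r11, crux `ConvexBisection.AcyclicBisectionExists`, item stmt-SmoothPoincare4-10508; registered
sub-goal `helper_rotField_spec`)

The prefix circles of a split Lefschetz link sit in the pages `pageDir (m+n) i` of the long word and
must be moved to the pages `pageDir m i` (NF6 T1, Baykur 2006, proof of Thm. 5.1: the fibred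
structure of `X₊ ⊃ F × D²`).  The cheapest faithful route is a fibred ambient isotopy of
`Base g = {rho g ≤ 1/4} ⊂ ℂ²` rotating the page coordinate `w = y² − x^{2g+1} − 1`; this file builds
its infinitesimal generator, a smooth compactly supported vector field `rotField g` on `ℝ⁴` with

* `fderiv_rho_rotField` — **`d rho(rotField) = 0` everywhere** (the flow preserves every level of
  `rho`, hence `Base g` and `∂ Base g`);
* `fderiv_w_rotField_of_le` — **`dw(rotField) = i·w` on `{rho ≤ 3/10}`** (near the base the flow
  rotates `w` at unit angular speed, preserving `‖w‖`);
* `cx_rotField_of_ge` — **`dx(rotField) = 0` over `‖x‖² ≥ 7/2`** (the flow fixes `x` near the rim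
  `‖x‖² = 4` of the flat part, so it preserves the region `‖x‖² < 4` carrying the pages
  `page g c = {‖x‖² < 4, w = c/2}` and maps `page g c` to `page g (e^{it} c)`);
* `contDiff_rotField`, `rotField_eq_zero_of_le` — smooth, zero off the compact set `{rho ≤ 2/5}`.

Construction (§4): `rotField = cutA(rho) · ((1 − cutB ‖x‖²) · n + cutB ‖x‖² · v)` blends the
horizontal normal `n = horizNormal g` (`dΦ(n) = i w`, `LefschetzBasePages.lean` §6; smooth off the
origin) over `‖x‖² ≤ 3` with the VERTICAL rotation field `v = (0, i w/(2y))` (`dΦ(v) = i w`,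
`dx(v) = 0`; smooth where `y ≠ 0`, which holds over `‖x‖² ≥ 3` near the base,
`cy_ne_zero_of_rho_lt_half`) over `‖x‖² ≥ 7/2`, by the cut-offs `cutA`, `cutB` built from
`Real.smoothTransition` (§3); any such convex combination still has `dΦ = i w`, whence
`d‖w‖² = 2 Re(w̄ · i w) = 0`, and the `eta`-term of `d rho` (formula `fderiv_rho_apply` of the
prequel) vanishes because `eta' = 0` over `‖x‖² < 4` while `dx = 0` over `‖x‖² ≥ 7/2` (§8).

Everything is proved; no named facts, no `sorry`.  References: R. İ. Baykur, *Kähler decomposition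
of 4-manifolds*, AGT 6 (2006), proof of Thm. 5.1 [Baykur2006]; R. E. Gompf, A. I. Stipsicz,
*4-Manifolds and Kirby Calculus* (1999), §8.2 (Lefschetz fibrations over `D²` as `F × D²` plus
fibred 2-handles).
-/

noncomputable section

set_option linter.dupNamespace false

open scoped Manifold ContDiff Topology ComplexConjugate
open Set Function Metric
open Literature.Topology.FourManifolds Literature.Topology.FourManifolds.LefschetzBase

namespace Summit.SmoothPoincare4.SmoothPoincare4.Theorems.AcyclicBisectionExists.ModpBraidOrbits

variable {g : ℕ}

/-! ## §1 Two smooth cut-offs -/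

/-- The support cut-off `cutA r = smoothTransition (4 − 10 r)`: `1` for `r ≤ 3/10`, `0` for
`r ≥ 2/5` (applied to `r = rho`). [folklore] -/
def cutA (r : ℝ) : ℝ := Real.smoothTransition (4 - 10 * r)

/-- `cutA = 1` on `r ≤ 3/10`. [folklore] -/
theorem cutA_of_le {r : ℝ} (h : r ≤ 3 / 10) : cutA r = 1 :=
  Real.smoothTransition.one_of_one_le (by linarith)

/-- `cutA = 0` on `r ≥ 2/5`. [folklore] -/
theorem cutA_of_ge {r : ℝ} (h : 2 / 5 ≤ r) : cutA r = 0 :=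
  Real.smoothTransition.zero_of_nonpos (by linarith)

/-- `cutA` is smooth. [folklore] -/
theorem contDiff_cutA : ContDiff ℝ ∞ cutA :=
  Real.smoothTransition.contDiff.comp (contDiff_const.sub (contDiff_const.mul contDiff_id))

/-- The blending cut-off `cutB s = smoothTransition (2 (s − 3))`: `0` for `s ≤ 3`, `1` for
`s ≥ 7/2` (applied to `s = ‖x‖²`). [folklore] -/
def cutB (s : ℝ) : ℝ := Real.smoothTransition (2 * (s - 3))

/-- `cutB = 0` on `s ≤ 3`. [folklore] -/
theorem cutB_of_le {s : ℝ} (h : s ≤ 3) : cutB s = 0 :=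
  Real.smoothTransition.zero_of_nonpos (by linarith)

/-- `cutB = 1` on `s ≥ 7/2`. [folklore] -/
theorem cutB_of_ge {s : ℝ} (h : 7 / 2 ≤ s) : cutB s = 1 :=
  Real.smoothTransition.one_of_one_le (by linarith)

/-- `cutB` is smooth. [folklore] -/
theorem contDiff_cutB : ContDiff ℝ ∞ cutB :=
  Real.smoothTransition.contDiff.comp (contDiff_const.mul (contDiff_id.sub contDiff_const))

/-! ## §2 The vertical field, the blended field and the rotation field -/

/-- **The vertical rotation field** `v(q) = (0, i w / (2y))`: `dΦ(v) = i w`, `dx(v) = 0` (it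
rotates `w` keeping `x` fixed; smooth where `y ≠ 0`). [folklore] -/
def vertField (g : ℕ) (q : EuclideanSpace ℝ (Fin 4)) : EuclideanSpace ℝ (Fin 4) :=
  mk 0 (Complex.I * w g q / dPhiY q)

/-- **The blended field** `(1 − cutB ‖x‖²) · n + cutB ‖x‖² · v`: the horizontal normal
`n = horizNormal` over `‖x‖² ≤ 3`, the vertical field over `‖x‖² ≥ 7/2`. [folklore] -/
def blendField (g : ℕ) (q : EuclideanSpace ℝ (Fin 4)) : EuclideanSpace ℝ (Fin 4) :=
  (1 - cutB (‖cx q‖ ^ 2)) • horizNormal g q + cutB (‖cx q‖ ^ 2) • vertField g q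

/-- **The page-rotation field** `rotField g = cutA (rho g) · blendField g`: the blended field cut
off to the neighbourhood `{rho < 2/5}` of the base `{rho ≤ 1/4}`. [folklore] -/
def rotField (g : ℕ) (q : EuclideanSpace ℝ (Fin 4)) : EuclideanSpace ℝ (Fin 4) :=
  cutA (rho g q) • blendField g q

/-! ## §3 Algebra: `dΦ` and `dx` of the fields -/

/-- `dx(v) = 0`. [folklore] -/
@[simp] theorem cx_vertField (q : EuclideanSpace ℝ (Fin 4)) : cx (vertField g q) = 0 := cx_mk _ _

/-- `dΦ(v) = i w` where `y ≠ 0`. [folklore] -/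
theorem dPhi_vertField {q : EuclideanSpace ℝ (Fin 4)} (hy : cy q ≠ 0) :
    dPhiX g q * cx (vertField g q) + dPhiY q * cy (vertField g q) = Complex.I * w g q := by
  have hb : dPhiY q ≠ 0 := by unfold dPhiY; exact mul_ne_zero two_ne_zero hy
  simp only [vertField, cx_mk, cy_mk, mul_zero, zero_add]
  rw [mul_div_cancel₀ _ hb]

/-- `dΦ(n) = i w` for the horizontal normal, off the origin. [folklore] -/
theorem dPhi_horizNormal {q : EuclideanSpace ℝ (Fin 4)} (hq : q ≠ 0) :
    dPhiX g q * cx (horizNormal g q) + dPhiY q * cy (horizNormal g q) = Complex.I * w g q := by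
  have hr : ((‖dPhiX g q‖ : ℂ) ^ 2 + (‖dPhiY q‖ : ℂ) ^ 2) ≠ 0 := by
    exact_mod_cast normSq_dPhi_ne_zero (g := g) hq
  simp only [horizNormal, cx_mk, cy_mk]
  have key : dPhiX g q * (Complex.I * w g q / ((‖dPhiX g q‖ ^ 2 + ‖dPhiY q‖ ^ 2 : ℝ) : ℂ) *
      conj (dPhiX g q)) + dPhiY q * (Complex.I * w g q /
      ((‖dPhiX g q‖ ^ 2 + ‖dPhiY q‖ ^ 2 : ℝ) : ℂ) * conj (dPhiY q)) =
      Complex.I * w g q / ((‖dPhiX g q‖ ^ 2 + ‖dPhiY q‖ ^ 2 : ℝ) : ℂ) *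
        (dPhiX g q * conj (dPhiX g q) + dPhiY q * conj (dPhiY q)) := by ring
  rw [key, Complex.mul_conj', Complex.mul_conj']
  push_cast
  exact div_mul_cancel₀ _ hr

/-- `cx`, `cy` of a real combination. [folklore] -/
theorem cx_smul_add_smul (a b : ℝ) (u v : EuclideanSpace ℝ (Fin 4)) :
    cx (a • u + b • v) = (a : ℂ) * cx u + (b : ℂ) * cx v := by
  rw [cx_add, cx_smul, cx_smul]

/-- `cx`, `cy` of a real combination. [folklore] -/
theorem cy_smul_add_smul (a b : ℝ) (u v : EuclideanSpace ℝ (Fin 4)) :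
    cy (a • u + b • v) = (a : ℂ) * cy u + (b : ℂ) * cy v := by
  rw [cy_add, cy_smul, cy_smul]

/-- `dΦ(blendField) = i w` off the origin, provided `y ≠ 0` wherever the vertical field is
switched on (`‖x‖² ≥ 3`). [folklore] -/
theorem dPhi_blendField {q : EuclideanSpace ℝ (Fin 4)} (hq : q ≠ 0)
    (hy : 3 ≤ ‖cx q‖ ^ 2 → cy q ≠ 0) :
    dPhiX g q * cx (blendField g q) + dPhiY q * cy (blendField g q) = Complex.I * w g q := by
  unfold blendField
  rw [cx_smul_add_smul, cy_smul_add_smul]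
  by_cases h3 : 3 ≤ ‖cx q‖ ^ 2
  · have hn := dPhi_horizNormal (g := g) hq
    have hv := dPhi_vertField (g := g) (hy h3)
    push_cast
    linear_combination (1 - (cutB (‖cx q‖ ^ 2) : ℂ)) * hn + (cutB (‖cx q‖ ^ 2) : ℂ) * hv
  · have hn := dPhi_horizNormal (g := g) hq
    rw [cutB_of_le (not_le.1 h3).le]
    push_cast
    linear_combination hn

/-- `dx(blendField) = 0` where `‖x‖² ≥ 7/2` (there the field is vertical). [folklore] -/
theorem cx_blendField_of_ge {q : EuclideanSpace ℝ (Fin 4)} (h : 7 / 2 ≤ ‖cx q‖ ^ 2) :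
    cx (blendField g q) = 0 := by
  unfold blendField
  rw [cx_smul_add_smul, cutB_of_ge h, cx_vertField]
  simp

/-! ## §4 Smoothness -/

/-- `dPhiX g` is smooth. [folklore] -/
theorem contDiff_dPhiX (g : ℕ) : ContDiff ℝ ∞ (dPhiX g) := by
  unfold dPhiX; exact (contDiff_const.mul (contDiff_cx.pow _)).neg

/-- `dPhiY` is smooth. [folklore] -/
theorem contDiff_dPhiY : ContDiff ℝ ∞ dPhiY := by
  unfold dPhiY; exact contDiff_const.mul contDiff_cy

/-- **The horizontal normal is smooth off the origin.** [folklore] -/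
theorem contDiffAt_horizNormal {q : EuclideanSpace ℝ (Fin 4)} (hq : q ≠ 0) :
    ContDiffAt ℝ ∞ (horizNormal g) q := by
  have hden : ContDiff ℝ ∞ fun p : EuclideanSpace ℝ (Fin 4) =>
      ((‖dPhiX g p‖ ^ 2 + ‖dPhiY p‖ ^ 2 : ℝ) : ℂ) :=
    Complex.ofRealCLM.contDiff.comp ((contDiff_norm_sq_complex.comp (contDiff_dPhiX g)).add
      (contDiff_norm_sq_complex.comp contDiff_dPhiY))
  have hlam : ContDiffAt ℝ ∞ (fun p : EuclideanSpace ℝ (Fin 4) =>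
      Complex.I * w g p / ((‖dPhiX g p‖ ^ 2 + ‖dPhiY p‖ ^ 2 : ℝ) : ℂ)) q := by
    simp only [div_eq_mul_inv]
    exact (contDiff_const.mul (contDiff_w g)).contDiffAt.mul
      (hden.contDiffAt.inv (Complex.ofReal_ne_zero.2 (normSq_dPhi_ne_zero hq)))
  have h := ContDiffAt.mk₂ (hlam.mul (Complex.conjCLE.contDiff.comp (contDiff_dPhiX g)).contDiffAt)
    (hlam.mul (Complex.conjCLE.contDiff.comp contDiff_dPhiY).contDiffAt)
  exact h

/-- The vertical field is smooth where `y ≠ 0`. [folklore] -/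
theorem contDiffAt_vertField {q : EuclideanSpace ℝ (Fin 4)} (hy : cy q ≠ 0) :
    ContDiffAt ℝ ∞ (vertField g) q := by
  have hb : dPhiY q ≠ 0 := by unfold dPhiY; exact mul_ne_zero two_ne_zero hy
  have h2 : ContDiffAt ℝ ∞ (fun p => Complex.I * w g p / dPhiY p) q := by
    simp only [div_eq_mul_inv]
    exact (contDiff_const.mul (contDiff_w g)).contDiffAt.mul (contDiff_dPhiY.contDiffAt.inv hb)
  exact ContDiffAt.mk₂ contDiffAt_const h2

/-- `q ↦ cutB ‖x‖²` is smooth. [folklore] -/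
theorem contDiff_cutB_cx : ContDiff ℝ ∞ fun q : EuclideanSpace ℝ (Fin 4) => cutB (‖cx q‖ ^ 2) :=
  contDiff_cutB.comp (contDiff_norm_sq_complex.comp contDiff_cx)

/-- The blended field is smooth off the origin wherever `y ≠ 0` over `‖x‖² ≥ 3` (over `‖x‖² < 3`
the vertical summand vanishes identically nearby). [folklore] -/
theorem contDiffAt_blendField {q : EuclideanSpace ℝ (Fin 4)} (hq : q ≠ 0)
    (hy : 3 ≤ ‖cx q‖ ^ 2 → cy q ≠ 0) : ContDiffAt ℝ ∞ (blendField g) q := by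
  have h1 : ContDiffAt ℝ ∞ (fun p => (1 - cutB (‖cx p‖ ^ 2)) • horizNormal g p) q :=
    (contDiff_const.sub contDiff_cutB_cx).contDiffAt.smul (contDiffAt_horizNormal hq)
  have h2 : ContDiffAt ℝ ∞ (fun p => cutB (‖cx p‖ ^ 2) • vertField g p) q := by
    by_cases h3 : 3 ≤ ‖cx q‖ ^ 2
    · exact contDiff_cutB_cx.contDiffAt.smul (contDiffAt_vertField (hy h3))
    · have hU : IsOpen {p : EuclideanSpace ℝ (Fin 4) | ‖cx p‖ ^ 2 < 3} :=
        isOpen_lt (contDiff_norm_sq_complex.comp contDiff_cx).continuous continuous_const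
      refine (contDiffAt_const (c := (0 : EuclideanSpace ℝ (Fin 4)))).congr_of_eventuallyEq ?_
      filter_upwards [hU.mem_nhds (not_le.1 h3)] with p hp
      rw [cutB_of_le (le_of_lt hp), zero_smul]
  exact h1.add h2

/-- **The page-rotation field is smooth on all of `ℝ⁴`.** [folklore] -/
theorem contDiff_rotField (g : ℕ) : ContDiff ℝ ∞ (rotField g) := by
  refine contDiff_iff_contDiffAt.2 fun q => ?_
  by_cases hρ : rho g q < 1 / 2
  · exact (contDiff_cutA.comp (contDiff_rho g)).contDiffAt.smul
      (contDiffAt_blendField (ne_zero_of_rho_lt_half hρ) (cy_ne_zero_of_rho_lt_half hρ))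
  · have hU : IsOpen {p : EuclideanSpace ℝ (Fin 4) | 2 / 5 < rho g p} :=
      isOpen_lt continuous_const (contDiff_rho g).continuous
    refine (contDiffAt_const (c := (0 : EuclideanSpace ℝ (Fin 4)))).congr_of_eventuallyEq ?_
    filter_upwards [hU.mem_nhds (show 2 / 5 < rho g q by linarith [not_lt.1 hρ])] with p hp
    simp only [rotField, cutA_of_ge (le_of_lt hp), zero_smul]

/-! ## §5 The three identities: support, rotation of `w`, tangency to the levels of `rho` -/

/-- The rotation field vanishes on `{rho ≥ 2/5}`. [folklore] -/
theorem rotField_eq_zero_of_le {q : EuclideanSpace ℝ (Fin 4)} (h : 2 / 5 ≤ rho g q) :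
    rotField g q = 0 := by
  simp only [rotField, cutA_of_ge h, zero_smul]

/-- `dx(rotField) = 0` over `‖x‖² ≥ 7/2`. [folklore] -/
theorem cx_rotField_of_ge {q : EuclideanSpace ℝ (Fin 4)} (h : 7 / 2 ≤ ‖cx q‖ ^ 2) :
    cx (rotField g q) = 0 := by
  rw [rotField, cx_smul, cx_blendField_of_ge h, mul_zero]

/-- **`dw(rotField) = cutA(rho) · i w` everywhere.** [folklore] -/
theorem fderiv_w_rotField (q : EuclideanSpace ℝ (Fin 4)) :
    fderiv ℝ (w g) q (rotField g q) = (cutA (rho g q) : ℂ) * (Complex.I * w g q) := by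
  by_cases hρ : rho g q < 1 / 2
  · rw [rotField, (fderiv ℝ (w g) q).map_smul, fderiv_w_apply,
      dPhi_blendField (ne_zero_of_rho_lt_half hρ) (cy_ne_zero_of_rho_lt_half hρ),
      Complex.real_smul]
  · have h : 2 / 5 ≤ rho g q := by linarith [not_lt.1 hρ]
    rw [rotField_eq_zero_of_le h, map_zero, cutA_of_ge h]
    simp

/-- **On `{rho ≤ 3/10}` (a neighbourhood of the base) `dw(rotField) = i w`**: the flow rotates
`w` at unit angular speed. [folklore] -/
theorem fderiv_w_rotField_of_le {q : EuclideanSpace ℝ (Fin 4)} (h : rho g q ≤ 3 / 10) :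
    fderiv ℝ (w g) q (rotField g q) = Complex.I * w g q := by
  rw [fderiv_w_rotField, cutA_of_le h, Complex.ofReal_one, one_mul]

/-- **The rotation field is tangent to the levels of `rho` everywhere**: `d rho(rotField) = 0`
(`d‖w‖²(V) = 2 cutA · Re(w̄ · i w) = 0`; the `eta` term vanishes since `eta' = 0` over
`‖x‖² < 4` and `dx(V) = 0` over `‖x‖² ≥ 7/2`). [folklore] -/
theorem fderiv_rho_rotField (q : EuclideanSpace ℝ (Fin 4)) :
    fderiv ℝ (rho g) q (rotField g q) = 0 := by
  rw [fderiv_rho_apply, fderiv_w_rotField]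
  have h1 : (conj (w g q) * ((cutA (rho g q) : ℂ) * (Complex.I * w g q))).re = 0 := by
    have e : conj (w g q) * ((cutA (rho g q) : ℂ) * (Complex.I * w g q)) =
        ((cutA (rho g q) * ‖w g q‖ ^ 2 : ℝ) : ℂ) * Complex.I := by
      push_cast
      rw [← Complex.conj_mul']
      ring
    rw [e, Complex.re_ofReal_mul, Complex.I_re, mul_zero]
  have h2 : deriv eta (‖cx q‖ ^ 2) * (2 * (conj (cx q) * cx (rotField g q)).re) = 0 := by
    by_cases hx : 7 / 2 ≤ ‖cx q‖ ^ 2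
    · rw [cx_rotField_of_ge hx, mul_zero, Complex.zero_re, mul_zero, mul_zero]
    · rw [(hasDerivAt_eta_of_lt (by linarith [not_le.1 hx])).deriv, zero_mul]
  rw [h1, h2, mul_zero, zero_add]

/-! ## §6 Compact support and the registered sub-goal -/

/-- The rotation field vanishes off the compact set `{rho g ≤ 2/5}`. [folklore] -/
theorem rotField_eq_zero_of_not_mem {q : EuclideanSpace ℝ (Fin 4)}
    (hq : q ∉ (rho g ⁻¹' Iic (2 / 5) : Set (EuclideanSpace ℝ (Fin 4)))) : rotField g q = 0 :=
  rotField_eq_zero_of_le (le_of_lt (not_le.1 hq))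

/-- **(R1) The page-rotation vector field of the Lefschetz base** (registered sub-goal
`helper_rotField_spec` of NF6, brick T1a): on `ℝ⁴ = ℂ² ⊃ Base g = {rho g ≤ 1/4}` there is a
smooth vector field `V` (namely `rotField g`) which vanishes off the compact neighbourhood
`{rho g ≤ 2/5}` of the base, is tangent to every level of `rho g` (so its flow preserves the base
and its boundary), rotates the page coordinate at unit speed near the base
(`dw(V) = i·w` on `{rho g ≤ 3/10}`), and fixes the coordinate `x` over `‖x‖² ≥ 7/2` (so its flow
preserves the flat part `‖x‖² < 4` carrying the pages).  This is the vector field whose flow is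
the fibred "page rotation" isotopy of `Base g ≅ F × D²` used to re-space the page angles of a
Lefschetz link (Baykur 2006, proof of Thm. 5.1; Gompf–Stipsicz 1999, §8.2).
[cite: Baykur2006, proof of Thm. 5.1, pp. 13–14] -/
theorem helper_rotField_spec :
    ∀ g : ℕ, ∃ V : EuclideanSpace ℝ (Fin 4) → EuclideanSpace ℝ (Fin 4),
      ContDiff ℝ ∞ V ∧
      IsCompact (Literature.Topology.FourManifolds.LefschetzBase.rho g ⁻¹' Set.Iic (2 / 5)) ∧
      (∀ q, q ∉ Literature.Topology.FourManifolds.LefschetzBase.rho g ⁻¹' Set.Iic (2 / 5) →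
        V q = 0) ∧
      (∀ q, fderiv ℝ (Literature.Topology.FourManifolds.LefschetzBase.rho g) q (V q) = 0) ∧
      (∀ q, Literature.Topology.FourManifolds.LefschetzBase.rho g q ≤ 3 / 10 →
        fderiv ℝ (Literature.Topology.FourManifolds.LefschetzBase.w g) q (V q) =
          Complex.I * Literature.Topology.FourManifolds.LefschetzBase.w g q) ∧
      (∀ q, 7 / 2 ≤ ‖Literature.Topology.FourManifolds.LefschetzBase.cx q‖ ^ 2 →
        Literature.Topology.FourManifolds.LefschetzBase.cx (V q) = 0) :=
  fun g => ⟨rotField g, contDiff_rotField g, isCompact_rho_le_two_fifths g,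
    fun _ hq => rotField_eq_zero_of_not_mem hq, fderiv_rho_rotField,
    fun _ hq => fderiv_w_rotField_of_le hq, fun _ hq => cx_rotField_of_ge hq⟩

end Summit.SmoothPoincare4.SmoothPoincare4.Theorems.AcyclicBisectionExists.ModpBraidOrbits
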